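import Literature.MathematicalPhysics.QuantumFieldTheory.Balaban1983to89.B13DirichletLocalCLetters
import Literature.MathematicalPhysics.QuantumFieldTheory.Balaban1983to89.B13XinvSymLettersOfReg335Located

/-!
# `Balaban1983to89.B13DirichletLocalCLettersLocated` — T. Bałaban, *Propagators for lattice gauge theories in a background field*, Commun. Math. Phys. **99** (1985)
# 389–434 [Balaban1985BackgroundPropagators], (3.25) p. 394, (3.35) p. 396, Thm 3.1 (3.42) p. 397, Thm 3.2 (3.48) p. 398, Thm 3.4 p. 400, (3.66)–(3.70) pp. 403–404, Sect. C
# pp. 408–409 («G′_□(U), C_□(U) = (Q′(U)G′_□²(U)Q′*(U))⁻¹ … satisfy all the inequalities of Theorems 3.1–3.3»), (3.87) p. 409, Thm 3.10 (3.107)–(3.108) p. 416, Thm 3.11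
# p. 416; [Balaban1984PropagatorsI] p. 25; [Balaban1984PropagatorsII] Prop 2.3 p. 238, (2.54) p. 232, Lemma 2.1 (2.61) p. 234, (2.69) p. 235; [Balaban1988RG2Cluster] (2.5)–(2.7)
# pp. 12–13, p. 15:
# ★★★ STATION L2 ON THE CLASS (3.35), EVERY DICTIONARY NUMERAL A NUMBER — the letters of `A′ ↦ C_□(e^{iηA′}U₀)` at dag-n10-w6's readings of record (`fineReadingY ∕
# blkReadingY i i.hN`) for EVERY background `U₀` of the class (3.35), with NO displayed N06 hypothesis: `G′_□`'s pencil letters by dag-n10-w3 g5's L1 §5 (module 78 at the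
# fine reading + dag-n06-w1's Theorem 3.1 coercivity of `Δ′_a(U₀)`), the X-station's numerals `D_Q = (d+1)(L^k − 1)`, `CQ = 1`, `CQs = (L^k)^{d+1}`, `r = (d+1)(L^k − 1)`,
# `m_S = m_B = N²` (this lineage's p623629 ∕ w4's `B13BlockBondReadingNumerals`), the centre by `B13DirichletLocalCLetters` §1 (regime-free).

[folklore] bookkeeping: ONE composition of cited tree theorems BY NAME; THEOREMS ONLY (no `def`, no `structure`, no instance, no notation); nothing of NODE 00's ∕ N06's
modified or restated; nothing here is a claim about the Yang–Mills mass gap; no node is discharged; count-neutral.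

WHY THIS FILE (cell `pub-ymgap`, HUMAN RULING D-0062, Track A node N10 = [B13]; seat `pub-ymgap-dag-n10-w5` g4; local-cube road L2, the «(3.35) instance as a corollary»
asked by the lane I.38258).  What is displayed after this file: `η`, the chart radius `Rc > 0`, L1's letters rate `ρ > 0`, L1's thin radius `0 < R₁ ≤ Rc` and rate `κ₁`
with L1's window (two inequalities between NUMBERS), a rate loss `0 < μ < κ₁`, the C-station's radius `0 ≤ R′ ≤ R₁` and rate `κ` with its window at `m = (4(d+1)+1)⁻²` —
all inequalities between numbers; the two letter constants (78's `B`, the X-station's `B_X`) are bound ONCE each by equation binders (`rfl` at the call site).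

HONEST FRAMING: a composition; chart ball around `U₀ ∈` (3.35) of LOCATED radius (∝ `L^{−2k}·Rc` at L1, thinner here), not print's class-uniform statement; finite-lattice
constants (`Θ = √((L^k)^{d+1})`), not print's `O(1)`; (3.48)'s multi-scale rate NOT claimed; which readings ∕ `η` ∕ `U₀` are «of record» is NODE 00's ∕ def-T's word;
nothing of Bałaban's asserted beyond the cited theorems; N06 ∕ N10 NOT discharged; K1⁹ NOT closed; counts unmoved (typed 28∕28 · discharged 5∕27); 0 `def`, 0 `sorry`,
standard axioms; one finite 𝕋⁴ programme at fixed ε — R4 closes the conditional finite-𝕋⁴ rung `BalabanLadder.UV` only; the YM mass gap (Clay) is NOT proved by any of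
this; nothing continuum ∕ ℝ⁴ ∕ OS.  Filed `--kind proof --supports` K1⁹ (stmt-QuantumFields-27364), Literature lane.
-/

noncomputable section

namespace Literature.MathematicalPhysics.QuantumFieldTheory.Balaban1983to89.B13DirichletLocalCLettersLocated

open Metric Set Finset Module
open scoped Matrix Matrix.Norms.L2Operator
open Literature.MathematicalPhysics.QuantumFieldTheory.Balaban1983to89
open Literature.MathematicalPhysics.QuantumFieldTheory.Balaban1983to89.B9Thm37GlueTorus (tdist1)
open Literature.MathematicalPhysics.QuantumFieldTheory.Balaban1983to89.B5TorusCover (UT)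
open Literature.MathematicalPhysics.QuantumFieldTheory.Balaban1983to89.B13EntrywiseWalks (RawEntryLetters)
open Literature.MathematicalPhysics.QuantumFieldTheory.Balaban1983to89.B9Thm37CubeCoverCommutators (cutMulY)
open Literature.MathematicalPhysics.QuantumFieldTheory.Balaban1983to89.B9Thm39CubeOpsAtLettersY (blkIndY)
open Literature.MathematicalPhysics.QuantumFieldTheory.Balaban1983to89.B13SiteReadingNumerals (fineReadingY hfib_fineReadingY_matrixUnits)
open Literature.MathematicalPhysics.QuantumFieldTheory.Balaban1983to89.B13BlockBondReadingNumerals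
  (blkReadingY hℓQ_blkReadingY hℓQs_blkReadingY card_fibre_blkReadingY_matrixUnits tdist_chart_blkCornerY_le_of_blkOf_eq)
open Literature.MathematicalPhysics.QuantumFieldTheory.Balaban1983to89.B9Eq3104CutoffCommutatorSizes (qpK_ne_zero_imp qpsK_ne_zero_imp)
open Literature.MathematicalPhysics.QuantumFieldTheory.Balaban1983to89.B9Thm39CinvSandwichQ (sum_abs_qpK_le_one)
open Literature.MathematicalPhysics.QuantumFieldTheory.Balaban1983to89.B13XinvSymLettersOfReg335Located (sum_abs_qpsK_row_le)
open Literature.MathematicalPhysics.QuantumFieldTheory.Balaban1983to89.B13DirichletLocalInverseLetters (rawEntryLetters_toMatrix_GsqY_parSymY_prodCfg_of_reg335_fineReading)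
open Literature.MathematicalPhysics.QuantumFieldTheory.Balaban1983to89.B13DirichletLocalCLetters (rawEntryLetters_toMatrix_ClocY_parSymY_prodCfg_of_GsqLetters)
open Literature.MathematicalPhysics.QuantumFieldTheory.Balaban1983to89.B9Eq39Adjoint (prodCfg)
open Literature.MathematicalPhysics.QuantumFieldTheory.Balaban1983to89.B6GlobalChartV1 (PV boxEquiv)
open Literature.MathematicalPhysics.QuantumFieldTheory.Balaban1983to89.B6KLevelCensusIndexV1 (KIdx kGeo)
open Literature.MathematicalPhysics.QuantumFieldTheory.Balaban1983to89.B9BackgroundsKLevelV1 (bg9K)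
open Literature.MathematicalPhysics.QuantumFieldTheory.Balaban1983to89.B6Geom246MultiLevelBox (blkOf)
open Literature.MathematicalPhysics.QuantumFieldTheory.Balaban1983to89.Node00.OpsYLocalInverse (GsqY)
open Literature.MathematicalPhysics.QuantumFieldTheory.Balaban1983to89.Node00.OpsYDeltaALocal (ClocY)
open Literature.MathematicalPhysics.QuantumFieldTheory.Balaban1983to89.Node00

variable {d ℓ : ℕ} {hd : 1 ≤ d + 1} {hL : Odd (ℓ + 1) ∧ 1 < ℓ + 1} {b₀ b₁ : ℝ}
variable (i : KIdx d ℓ hd hL b₀ b₁) {N : ℕ} [NeZero N] {G : Subgroup (Matrix (Fin N) (Fin N) ℂ)ˣ} [DecidableEq (BlkY i)]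

/-- ★★★ **`C_□` ALONG THE PENCIL ABOUT A (3.35) BACKGROUND AT THE READINGS OF RECORD — NO DISPLAYED N06 HYPOTHESIS, EVERY DICTIONARY NUMERAL A NUMBER** (v4 letter
`parSymY`, `G ≤ U(N)`, `1 ≤ N`, `U₀` in the class (3.35) with `0 ≤ c·M·α₀`, `c·M·α₀·(d+1) ≤ 1∕16`; ANY site set `D` and block set `Dblk` with the sites of `Dblk` in `D`):
L1 §5 (`G′_□`'s letters at `fineReadingY`, radius `R₁`, rate `κ₁`, constant `B_G′ = 4∕m₁′`, `m₁ = min((1∕8)(L^k)⁻², 1)`) ∘ `B13DirichletLocalCLetters.…_of_GsqLetters` at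
`D_Q = (d+1)(L^k − 1)`, `CQ = 1`, `CQs = (L^k)^{d+1}`, `r = (d+1)(L^k − 1)`, `m_S = m_B = N²`, readings `fineReadingY ∕ blkReadingY i i.hN` ⟹
`RawEntryLetters (A′ ↦ toMatrix B_B B_B (C_□(e^{iηA′}U₀))) (blkReadingY ∘ fst) R′ κ (1·Θ·(4∕m′))`, `m′ = (4(d+1)+1)⁻² − 2·((Θ·1·(B_X+1))·(N²·c₀(1,κ₁−μ)^{d+1}))·R′∕R₁`.
[cite: Balaban1985BackgroundPropagators, (3.25) p.394, (3.35) p.396, Thm 3.1 (3.42) p.397, Thm 3.2 (3.48) p.398, Thm 3.4 p.400, (3.66)–(3.70) pp.403–404, (3.87) p.409,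
Thm 3.10 (3.107)–(3.108) p.416, Thm 3.11 p.416; Balaban1984PropagatorsI, p.25; Balaban1984PropagatorsII, Prop 2.3 p.238, (2.54) p.232, Lemma 2.1 (2.61) p.234, (2.69) p.235;
Balaban1988RG2Cluster, (2.5)–(2.7) pp.12–13, p.15] -/
theorem rawEntryLetters_toMatrix_ClocY_parSymY_prodCfg_of_reg335_located
    (hG : G ≤ B7Prop2Explicit.unitaryUnits (Matrix (Fin N) (Fin N) ℂ))
    {U₀ : CfgY (Matrix (Fin N) (Fin N) ℂ) i} {c α₀ : ℝ} (hC0 : 0 ≤ c * (kGeo i).M * α₀) (hC1 : c * (kGeo i).M * α₀ * ((d : ℝ) + 1) ≤ 1 / 16)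
    (hreg : (bg9K (Matrix (Fin N) (Fin N) ℂ) G i).Reg335 c α₀ U₀) (D : Finset (SiteY i)) {Dblk : Finset (BlkY i)}
    (hDD : ∀ z : SiteY i, blkOf i.D.toDomains z ∈ Dblk → z ∈ D)
    (η : ℝ) {Rc : ℝ} (hRc : 0 < Rc) {ρ : ℝ} (hρ : 0 < ρ)
    -- module 78's letters constant at the fine-reading numerals (L1 §5's binder), bound once (`rfl` at the call site)
    {B : ℝ} (hB : B = (1 * (((d : ℝ) + 1) *
          (1 * Real.exp (|η| * Rc) * (1 * Real.exp (|η| * Rc) * 1 * (1 * Real.exp (|η| * Rc)) + 1) * (1 * Real.exp (|η| * Rc)) +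
            (1 * Real.exp (|η| * Rc) * 1 * (1 * Real.exp (|η| * Rc)) + 1)) +
          1 * ((1 * Real.exp (|η| * Rc)) ^ (2 * (d + 1) * ((ℓ + 1) ^ i.k - 1)) * 1 * (1 * Real.exp (|η| * Rc)) ^ (2 * (d + 1) * ((ℓ + 1) ^ i.k - 1)))) *
          Real.exp (ρ * (((d : ℝ) + 1) * ((((ℓ + 1) ^ i.k : ℕ) : ℝ))))))
    -- L1's thin radius and window
    {R₁ : ℝ} (hR₁ : 0 < R₁) (hR₁R : R₁ ≤ Rc)
    (hmarg₁ : 0 < min ((1 / 8 : ℝ) * (((((ℓ + 1) ^ i.k : ℕ) : ℝ)) ^ 2)⁻¹) 1 - 2 * ((B + 1) * ((N * N : ℕ) * B6.c0 1 ρ ^ (d + 1))) * R₁ / Rc)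
    {κ₁ : ℝ} (hκ₁ : 0 < κ₁) (hκ₁4 : κ₁ ≤ ρ / 4)
    (hκ₁m : 8 * (B + 1) * κ₁ * ((N * N : ℕ) * B6.c0 1 (ρ / 2) ^ (d + 1)) ≤
      (min ((1 / 8 : ℝ) * (((((ℓ + 1) ^ i.k : ℕ) : ℝ)) ^ 2)⁻¹) 1 - 2 * ((B + 1) * ((N * N : ℕ) * B6.c0 1 ρ ^ (d + 1))) * R₁ / Rc) * ρ)
    -- the X-station's rate loss and constant (bound once, `rfl` at the call site)
    {μ : ℝ} (hμ : 0 < μ) (hμκ : μ < κ₁)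
    {BX : ℝ} (hBX : BX = 1 * (Fintype.card (Fin N × Fin N) : ℝ) *
          (1 * ((1 * Real.exp (|η| * Rc)) ^ ((d + 1) * ((ℓ + 1) ^ i.k - 1)) * 1 * (1 * Real.exp (|η| * Rc)) ^ ((d + 1) * ((ℓ + 1) ^ i.k - 1)))) *
        ((((ℓ : ℝ) + 1) ^ i.k) ^ (d + 1) * (Fintype.card (Fin N × Fin N) : ℝ) *
          (1 * ((1 * Real.exp (|η| * Rc)) ^ ((d + 1) * ((ℓ + 1) ^ i.k - 1)) * 1 * (1 * Real.exp (|η| * Rc)) ^ ((d + 1) * ((ℓ + 1) ^ i.k - 1))))) *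
        (4 / (min ((1 / 8 : ℝ) * (((((ℓ + 1) ^ i.k : ℕ) : ℝ)) ^ 2)⁻¹) 1 - 2 * ((B + 1) * ((N * N : ℕ) * B6.c0 1 ρ ^ (d + 1))) * R₁ / Rc) *
          (4 / (min ((1 / 8 : ℝ) * (((((ℓ + 1) ^ i.k : ℕ) : ℝ)) ^ 2)⁻¹) 1 - 2 * ((B + 1) * ((N * N : ℕ) * B6.c0 1 ρ ^ (d + 1))) * R₁ / Rc)) *
          (((N * N : ℕ) : ℝ) * B6.c0 1 μ ^ (d + 1))) *
        Real.exp (2 * (κ₁ - μ) * (((d : ℝ) + 1) * (((((ℓ + 1) ^ i.k : ℕ) : ℝ)) - 1))))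
    -- the C-station's radius and window at `m = (4(d+1)+1)⁻²`
    {R' : ℝ} (hR' : 0 ≤ R') (hR'R : R' ≤ R₁)
    (hmarg : 0 < ((4 * ((d : ℝ) + 1) + 1) ^ 2)⁻¹ -
      2 * ((Real.sqrt ((((ℓ : ℝ) + 1) ^ i.k) ^ (d + 1)) * 1 * (BX + 1)) * (((N * N : ℕ) : ℝ) * B6.c0 1 (κ₁ - μ) ^ (d + 1))) * R' / R₁)
    {κ : ℝ} (hκ : 0 ≤ κ) (hκ4 : κ ≤ (κ₁ - μ) / 4)
    (hκm : 8 * (Real.sqrt ((((ℓ : ℝ) + 1) ^ i.k) ^ (d + 1)) * 1 * (BX + 1)) * κ * (((N * N : ℕ) : ℝ) * B6.c0 1 ((κ₁ - μ) / 2) ^ (d + 1)) ≤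
      (((4 * ((d : ℝ) + 1) + 1) ^ 2)⁻¹ -
        2 * ((Real.sqrt ((((ℓ : ℝ) + 1) ^ i.k) ^ (d + 1)) * 1 * (BX + 1)) * (((N * N : ℕ) : ℝ) * B6.c0 1 (κ₁ - μ) ^ (d + 1))) * R' / R₁) * (κ₁ - μ)) :
    RawEntryLetters (fun a : Fin (d + 1) → Site (PV d ℓ i.m i.K hd hL) 0 → Matrix (Fin N) (Fin N) ℂ =>
        LinearMap.toMatrix
          ((Pi.basis fun _ : BlkY i => Matrix.stdBasis ℂ (Fin N) (Fin N)).reindex (Equiv.sigmaEquivProd (BlkY i) (Fin N × Fin N)))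
          ((Pi.basis fun _ : BlkY i => Matrix.stdBasis ℂ (Fin N) (Fin N)).reindex (Equiv.sigmaEquivProd (BlkY i) (Fin N × Fin N)))
          (ClocY i (parSymY i) D (cutMulY (blkIndY i Dblk)) (prodCfg U₀ η a))) (fun p : BlkY i × (Fin N × Fin N) => blkReadingY i i.hN p.1) R'
      κ (1 * Real.sqrt ((((ℓ : ℝ) + 1) ^ i.k) ^ (d + 1)) *
        (4 / (((4 * ((d : ℝ) + 1) + 1) ^ 2)⁻¹ -
          2 * ((Real.sqrt ((((ℓ : ℝ) + 1) ^ i.k) ^ (d + 1)) * 1 * (BX + 1)) * (((N * N : ℕ) : ℝ) * B6.c0 1 (κ₁ - μ) ^ (d + 1))) * R' / R₁))) := by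
  -- L1 §5: `G′_□`'s pencil letters at the fine reading, `(R₁, κ₁, 4∕m₁′)`
  have hGsq := rawEntryLetters_toMatrix_GsqY_parSymY_prodCfg_of_reg335_fineReading i hG hC0 hC1 hreg D η hRc.le hρ hB hR₁.le hR₁R hmarg₁ hκ₁.le hκ₁4 hκ₁m
  have hCQs0 : (0 : ℝ) ≤ (((ℓ : ℝ) + 1) ^ i.k) ^ (d + 1) := by positivity
  exact rawEntryLetters_toMatrix_ClocY_parSymY_prodCfg_of_GsqLetters i hG hreg.1 η D hDD hR₁ hR₁R
    (fun _ _ h => tdist_chart_blkCornerY_le_of_blkOf_eq i (qpK_ne_zero_imp i h)) (fun _ _ h => tdist_chart_blkCornerY_le_of_blkOf_eq i (qpsK_ne_zero_imp i h))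
    zero_le_one (sum_abs_qpK_le_one i) hCQs0 (sum_abs_qpsK_row_le i)
    (fineReadingY i i.hN) (blkReadingY i i.hN) (hℓQ_blkReadingY i i.hN) (hℓQs_blkReadingY i i.hN)
    (hfib_fineReadingY_matrixUnits i i.hN) (card_fibre_blkReadingY_matrixUnits i i.hN) hGsq hμ hμκ hBX hR' hR'R hmarg hκ hκ4 hκm

end Literature.MathematicalPhysics.QuantumFieldTheory.Balaban1983to89.B13DirichletLocalCLettersLocated

end
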